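import Summits.BirchSwinnertonDyer.BirchSwinnertonDyer.Theorems.DefiniteThetaDerivedHeightCapTowerSqrtPadicJets
import Literature.NumberTheory.EllipticCurves.IwasawaAlgebraGroupRingLimit
import HarnessLib

/-!
# One layer of the Iwasawa–Serre identification: `ℤ_p⟦X⟧/(ω_e) → ℤ_p[G]`, `X ↦ γ − 1`, for `G` cyclic of order `p^e`

Route-independent `Theorems` file (cell `b2b-bsdres`, seat `b2b-bsdres-x10b`, gen 46), part 16 of the series «tower square root»
serving crux `DerivedHeightCap` (stmt-BirchSwinnertonDyer-18438, route DefiniteTheta) — route DefiniteTheta's definition request D2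
("the identification `completedGroupRing ≅ Λ = ℤ_p⟦T⟧` (Iwasawa–Serre), to state CH15 Thm 1 as a named fact over `GrossPointTower`").
HONEST FRAMING: no curve asserted, no class closed, BSD not proved by any of this.

For a finite commutative group `G` generated by `γ` with `Nat.card G = p^e` (so `ℤ_p[G] ≅ ℤ_p[X]/(ω_e)`, `ω_e = (X+1)^{p^e} − 1`, part 1),
a power series `L ∈ ℤ_p⟦X⟧` has a well-defined image in `ℤ_p[G]`: Weierstrass division by the distinguished polynomial `ω_e`
(Mathlib `PowerSeries.IsWeierstrassDivisorAt`, the tree's `IwasawaOmega.isWeierstrassDivisorAt_omega`) gives a polynomial `R` with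
`ω_e ∣ L − R` in `ℤ_p⟦X⟧`, and `R(γ − 1) ∈ ℤ_p[G]` does not depend on `R`.  NO definition is introduced: "`θ` is the image of `L`" is
the relation

  `∀ R : ℤ_p[X], ω_e ∣ L − R (in ℤ_p⟦X⟧) → R(γ − 1) = θ`,

written out in every statement (as `ω_e` is).  This file proves:

* §1 `coe_omegaPoly` (the polynomial `ω_e` of parts 1–3 coerces to the power series `ω_e` of `IwasawaOmega`), `span_p_ne_top`,
  `omegaPoly_dvd_of_omega_dvd_coe` (**`ω_e ∣ P` in `ℤ_p⟦X⟧` ⇒ `ω_e ∣ P` in `ℤ_p[X]`** for a polynomial `P`: uniqueness of Weierstrass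
  division), `pow_dvd_coeff_of_omega_dvd` (`ω_e ∣ A ⇒ p^{e−k} ∣ coeff_k A`, Kummer);
* §2 `exists_poly_omega_dvd_sub` (a representative `R`, `deg R < p^e`), `aeval_eq_of_omega_dvd_coe_sub` (well-definedness),
  `omega_dvd_coe_sub_of_aeval_eq` (the kernel is exactly `(ω_e)`), hence `existsUnique_image` (**every `L` has exactly one image `θ`**),
  `image_iff_exists`, `omega_dvd_sub_of_image_of_image` (two power series with the same image agree modulo `ω_e`);
* §3 the relation is a ring homomorphism: `image_coe` (`P ↦ P(γ−1)`), `image_add`, `image_mul`, `image_surjective`;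
* §4 ideals: `mem_augIdeal_pow_of_image` (`L ∈ (X^ρ)` ⇒ `θ ∈ I^ρ`), `exists_X_pow_mul_of_mem_augIdeal_pow` (`θ ∈ I^ρ` ⇒ `L ≡ X^ρ Q
  (mod ω_e)` for a polynomial `Q`), `not_isUnit_coeff_of_image_of_C_dvd` (`p ∣ L` ⇒ no coefficient of `θ` is a unit),
  `dvd_coeff_of_image_of_forall_not_isUnit` (no unit coefficient ⇒ `p ∣ coeff_k L` for all `k < e`).

## References
* [Washington1997] L. C. Washington, *Introduction to Cyclotomic Fields*, 2nd ed., §7.1, Thm. 7.1, Prop. 7.2.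
* [BertoliniDarmon2005] M. Bertolini, H. Darmon, Ann. of Math. 162 (2005), §1.2 (18)–(21).
-/

noncomputable section

open scoped BigOperators Polynomial

-- D-0017: single-problem summit, the namespace repeats the problem name by design.
set_option linter.dupNamespace false

namespace Summit.BirchSwinnertonDyer.BirchSwinnertonDyer.Theorems.TowerSqrt

open Literature.NumberTheory.EllipticCurves (augIdeal augmentation augmentation_single mem_augIdeal_iff)
open Literature.NumberTheory.EllipticCurves.IwasawaOmega (isWeierstrassDivisorAt_omega order_map_omega coeff_omega)

variable (p : ℕ) [hp : Fact p.Prime]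

/-! ### §1 The polynomial `ω_e` inside `ℤ_p⟦X⟧` -/

/-- The polynomial `ω_e = (X+1)^{p^e} − 1` of parts 1–3, coerced to `ℤ_p⟦X⟧`, is the power series `(1+X)^{p^e} − 1` of `IwasawaOmega`.
[folklore] -/
theorem coe_omegaPoly (e : ℕ) :
    ((((Polynomial.X + 1 : ℤ_[p][X]) ^ (p ^ e) - 1 : ℤ_[p][X])) : PowerSeries ℤ_[p]) =
      (1 + PowerSeries.X : PowerSeries ℤ_[p]) ^ p ^ e - 1 := by
  rw [Polynomial.coe_sub, Polynomial.coe_pow, Polynomial.coe_add, Polynomial.coe_one, Polynomial.coe_X, add_comm]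

/-- `(p) ≠ ℤ_p` (it is the maximal ideal). [folklore] -/
theorem span_p_ne_top : Ideal.span {(p : ℤ_[p])} ≠ ⊤ := by
  rw [← PadicInt.maximalIdeal_eq_span_p]
  exact (IsLocalRing.maximalIdeal.isMaximal ℤ_[p]).ne_top

/-- `p` is not a unit of `ℤ_p`. [folklore] -/
theorem not_isUnit_p : ¬ IsUnit (p : ℤ_[p]) := by
  have h : (p : ℤ_[p]) ∈ IsLocalRing.maximalIdeal ℤ_[p] := by
    rw [PadicInt.maximalIdeal_eq_span_p]; exact Ideal.mem_span_singleton_self _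
  exact (IsLocalRing.mem_maximalIdeal _).mp h

/-- **`ω_e ∣ P` in `ℤ_p⟦X⟧` implies `ω_e ∣ P` in `ℤ_p[X]`** for a polynomial `P`: divide `P` by the monic `ω_e` in `ℤ_p[X]`; the
remainder, of degree `< p^e`, is a power-series multiple of `ω_e`, hence `0` by the uniqueness of Weierstrass division
(Mathlib `PowerSeries.IsWeierstrassDivisorAt.eq_zero_of_mul_eq`). [cite: Washington1997, §7.1 Prop. 7.2] -/
theorem omegaPoly_dvd_of_omega_dvd_coe (e : ℕ) {P : ℤ_[p][X]}
    (h : ((1 + PowerSeries.X : PowerSeries ℤ_[p]) ^ p ^ e - 1) ∣ (P : PowerSeries ℤ_[p])) :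
    ((Polynomial.X + 1 : ℤ_[p][X]) ^ (p ^ e) - 1) ∣ P := by
  haveI : IsAdicComplete (Ideal.span {(p : ℤ_[p])}) ℤ_[p] := by rw [← PadicInt.maximalIdeal_eq_span_p]; infer_instance
  set ω : ℤ_[p][X] := (Polynomial.X + 1 : ℤ_[p][X]) ^ (p ^ e) - 1 with hω
  have hmonic : ω.Monic := omegaPoly_monic p e
  -- polynomial division
  have hdiv : P = ω * (P /ₘ ω) + P %ₘ ω := (Polynomial.modByMonic_add_div P ω).symm.trans (add_comm _ _)
  -- the remainder is a power-series multiple of ω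
  obtain ⟨s, hs⟩ := h
  have hr : ((1 + PowerSeries.X : PowerSeries ℤ_[p]) ^ p ^ e - 1) * (s - ((P /ₘ ω : ℤ_[p][X]) : PowerSeries ℤ_[p])) =
      ((P %ₘ ω : ℤ_[p][X]) : PowerSeries ℤ_[p]) := by
    have h1 : ((P %ₘ ω : ℤ_[p][X]) : PowerSeries ℤ_[p]) = (P : PowerSeries ℤ_[p]) - ((ω * (P /ₘ ω) : ℤ_[p][X]) : PowerSeries ℤ_[p]) := by
      rw [eq_sub_iff_add_eq, ← Polynomial.coe_add, add_comm, ← hdiv]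
    rw [h1, Polynomial.coe_mul, hω, coe_omegaPoly, hs, mul_sub]
  have H := isWeierstrassDivisorAt_omega (S := ℤ_[p]) p (span_p_ne_top p) e
  have hdeg : (P %ₘ ω).degree <
      ((PowerSeries.map (Ideal.Quotient.mk (Ideal.span {(p : ℤ_[p])}))) ((1 + PowerSeries.X : PowerSeries ℤ_[p]) ^ p ^ e - 1)).order.toNat := by
    rw [order_map_omega p (span_p_ne_top p) e]
    have h2 := Polynomial.degree_modByMonic_lt P hmonic
    rw [Polynomial.degree_eq_natDegree hmonic.ne_zero, natDegree_omegaPoly] at h2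
    exact_mod_cast h2
  have hz := (H.eq_zero_of_mul_eq hdeg hr).2
  rw [hdiv, hz, add_zero]
  exact dvd_mul_right ω _

/-- Conversely (trivially): `ω_e ∣ P` in `ℤ_p[X]` implies `ω_e ∣ P` in `ℤ_p⟦X⟧`. [folklore] -/
theorem omega_dvd_coe_of_omegaPoly_dvd (e : ℕ) {P : ℤ_[p][X]}
    (h : ((Polynomial.X + 1 : ℤ_[p][X]) ^ (p ^ e) - 1) ∣ P) :
    ((1 + PowerSeries.X : PowerSeries ℤ_[p]) ^ p ^ e - 1) ∣ (P : PowerSeries ℤ_[p]) := by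
  obtain ⟨Q, rfl⟩ := h
  rw [Polynomial.coe_mul, coe_omegaPoly]
  exact dvd_mul_right _ _

/-- **Kummer bound for power-series multiples of `ω_e`**: if `ω_e ∣ A` in `ℤ_p⟦X⟧` then `p^{e−k} ∣ coeff_k A`
(`coeff_0 ω_e = 0` and `p^{e−k} ∣ C(p^e, j)` for `1 ≤ j ≤ k`, part 2 §1). [folklore] -/
theorem pow_dvd_coeff_of_omega_dvd (e k : ℕ) {A : PowerSeries ℤ_[p]}
    (h : ((1 + PowerSeries.X : PowerSeries ℤ_[p]) ^ p ^ e - 1) ∣ A) :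
    (p : ℤ_[p]) ^ (e - k) ∣ PowerSeries.coeff k A := by
  obtain ⟨s, rfl⟩ := h
  rw [PowerSeries.coeff_mul]
  refine Finset.dvd_sum fun ij hij => ?_
  have hle : ij.1 ≤ k := by
    have := Finset.mem_antidiagonal.mp hij
    omega
  refine dvd_mul_of_dvd_left ?_ _
  rw [coeff_omega]
  split_ifs with h0
  · exact dvd_zero _
  · have h1 := pow_dvd_choose_prime_pow p hp.out e ij.1 k (Nat.one_le_iff_ne_zero.mpr h0) hle
    have := Nat.cast_dvd_cast (α := ℤ_[p]) h1
    push_cast at this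
    exact this

/-! ### §2 One layer: representatives, well-definedness, the kernel -/

/-- **A polynomial representative modulo `ω_e`**: every `L ∈ ℤ_p⟦X⟧` is `≡ R (mod ω_e)` for a polynomial `R` of degree `< p^e`
(Weierstrass division by `ω_e ≡ X^{p^e} (mod p)`). [cite: Washington1997, §7.1 Prop. 7.2] -/
theorem exists_poly_omega_dvd_sub (e : ℕ) (L : PowerSeries ℤ_[p]) :
    ∃ R : ℤ_[p][X], R.degree < (p ^ e : ℕ) ∧
      ((1 + PowerSeries.X : PowerSeries ℤ_[p]) ^ p ^ e - 1) ∣ L - (R : PowerSeries ℤ_[p]) := by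
  haveI : IsAdicComplete (Ideal.span {(p : ℤ_[p])}) ℤ_[p] := by rw [← PadicInt.maximalIdeal_eq_span_p]; infer_instance
  have H := isWeierstrassDivisorAt_omega (S := ℤ_[p]) p (span_p_ne_top p) e
  have hdiv := H.isWeierstrassDivisionAt_div_mod L
  refine ⟨H.mod L, ?_, ⟨H.div L, ?_⟩⟩
  · have h1 := hdiv.degree_lt
    rwa [order_map_omega p (span_p_ne_top p) e] at h1
  · rw [sub_eq_iff_eq_add]
    exact hdiv.eq_mul_add

section Level

variable {G : Type*} [CommGroup G]

/-- **Well-definedness**: if `ω_e ∣ P − Q` in `ℤ_p⟦X⟧` then `P(γ − 1) = Q(γ − 1)` in `ℤ_p[G]` (`γ^{p^e} = 1`): by §1 the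
divisibility holds in `ℤ_p[X]`, and `ω_e(γ − 1) = 0` (part 1). [cite: Washington1997, §7.1 Thm. 7.1] -/
theorem aeval_eq_of_omega_dvd_coe_sub (γ : G) (e : ℕ) (hγ : γ ^ (p ^ e) = 1) {P Q : ℤ_[p][X]}
    (h : ((1 + PowerSeries.X : PowerSeries ℤ_[p]) ^ p ^ e - 1) ∣ (P : PowerSeries ℤ_[p]) - (Q : PowerSeries ℤ_[p])) :
    (Polynomial.aeval (R := ℤ_[p]) (MonoidAlgebra.of ℤ_[p] _ γ - 1)) P =
      (Polynomial.aeval (R := ℤ_[p]) (MonoidAlgebra.of ℤ_[p] _ γ - 1)) Q := by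
  rw [← Polynomial.coe_sub] at h
  obtain ⟨S, hS⟩ := omegaPoly_dvd_of_omega_dvd_coe p e h
  rw [← sub_eq_zero, ← map_sub, hS, map_mul, evalGen_omegaPoly p γ e hγ, zero_mul]

/-- **The kernel is `(ω_e)`**: if `P(γ − 1) = Q(γ − 1)` in `ℤ_p[G]` (`γ` a generator, `#G = p^e`) then `ω_e ∣ P − Q` in `ℤ_p⟦X⟧`
(part 1 §3). [cite: Washington1997, §7.1 Thm. 7.1] -/
theorem omega_dvd_coe_sub_of_aeval_eq [Finite G] (γ : G) (e : ℕ) (hγ : γ ^ (p ^ e) = 1)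
    (hgen : ∀ g : G, ∃ k : ℕ, γ ^ k = g) (hcard : Nat.card G = p ^ e) {P Q : ℤ_[p][X]}
    (h : (Polynomial.aeval (R := ℤ_[p]) (MonoidAlgebra.of ℤ_[p] _ γ - 1)) P =
      (Polynomial.aeval (R := ℤ_[p]) (MonoidAlgebra.of ℤ_[p] _ γ - 1)) Q) :
    ((1 + PowerSeries.X : PowerSeries ℤ_[p]) ^ p ^ e - 1) ∣ (P : PowerSeries ℤ_[p]) - (Q : PowerSeries ℤ_[p]) := by
  rw [← Polynomial.coe_sub]
  refine omega_dvd_coe_of_omegaPoly_dvd p e (omegaPoly_dvd_of_evalGen_eq_zero p γ e hγ hgen hcard ?_)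
  rw [map_sub, h, sub_self]

/-- **Existence and uniqueness of the image**: every `L ∈ ℤ_p⟦X⟧` has exactly one `θ ∈ ℤ_p[G]` with `R(γ − 1) = θ` for every
polynomial `R ≡ L (mod ω_e)` — the map `ℤ_p⟦X⟧ → ℤ_p⟦X⟧/(ω_e) ≅ ℤ_p[X]/(ω_e) ≅ ℤ_p[G]`. [cite: Washington1997, §7.1 Thm. 7.1] -/
theorem existsUnique_image (γ : G) (e : ℕ) (hγ : γ ^ (p ^ e) = 1) (L : PowerSeries ℤ_[p]) :
    ∃! θ : MonoidAlgebra ℤ_[p] G, ∀ R : ℤ_[p][X],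
      ((1 + PowerSeries.X : PowerSeries ℤ_[p]) ^ p ^ e - 1) ∣ L - (R : PowerSeries ℤ_[p]) →
        (Polynomial.aeval (R := ℤ_[p]) (MonoidAlgebra.of ℤ_[p] _ γ - 1)) R = θ := by
  obtain ⟨R₀, -, hR₀⟩ := exists_poly_omega_dvd_sub p e L
  refine ⟨(Polynomial.aeval (R := ℤ_[p]) (MonoidAlgebra.of ℤ_[p] _ γ - 1)) R₀, fun R hR => ?_, fun θ hθ => (hθ R₀ hR₀).symm⟩
  refine aeval_eq_of_omega_dvd_coe_sub p γ e hγ ?_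
  have := dvd_sub hR₀ hR
  rwa [sub_sub_sub_cancel_left] at this

/-- The image relation, unfolded: `θ` is the image of `L` iff SOME representative `R ≡ L (mod ω_e)` has `R(γ − 1) = θ`. [folklore] -/
theorem image_iff_exists (γ : G) (e : ℕ) (hγ : γ ^ (p ^ e) = 1) (L : PowerSeries ℤ_[p]) (θ : MonoidAlgebra ℤ_[p] G) :
    (∀ R : ℤ_[p][X], ((1 + PowerSeries.X : PowerSeries ℤ_[p]) ^ p ^ e - 1) ∣ L - (R : PowerSeries ℤ_[p]) →
        (Polynomial.aeval (R := ℤ_[p]) (MonoidAlgebra.of ℤ_[p] _ γ - 1)) R = θ) ↔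
      ∃ R : ℤ_[p][X], ((1 + PowerSeries.X : PowerSeries ℤ_[p]) ^ p ^ e - 1) ∣ L - (R : PowerSeries ℤ_[p]) ∧
        (Polynomial.aeval (R := ℤ_[p]) (MonoidAlgebra.of ℤ_[p] _ γ - 1)) R = θ := by
  constructor
  · intro h
    obtain ⟨R₀, -, hR₀⟩ := exists_poly_omega_dvd_sub p e L
    exact ⟨R₀, hR₀, h R₀ hR₀⟩
  · rintro ⟨R₀, hR₀, hθ⟩ R hR
    rw [← hθ]
    refine aeval_eq_of_omega_dvd_coe_sub p γ e hγ ?_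
    have := dvd_sub hR₀ hR
    rwa [sub_sub_sub_cancel_left] at this

/-- **Two power series with the same image agree modulo `ω_e`** (`γ` a generator, `#G = p^e`). [cite: Washington1997, §7.1 Thm. 7.1] -/
theorem omega_dvd_sub_of_image_of_image [Finite G] (γ : G) (e : ℕ) (hγ : γ ^ (p ^ e) = 1)
    (hgen : ∀ g : G, ∃ k : ℕ, γ ^ k = g) (hcard : Nat.card G = p ^ e) {L L' : PowerSeries ℤ_[p]} {θ : MonoidAlgebra ℤ_[p] G}
    (hL : ∀ R : ℤ_[p][X], ((1 + PowerSeries.X : PowerSeries ℤ_[p]) ^ p ^ e - 1) ∣ L - (R : PowerSeries ℤ_[p]) →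
      (Polynomial.aeval (R := ℤ_[p]) (MonoidAlgebra.of ℤ_[p] _ γ - 1)) R = θ)
    (hL' : ∀ R : ℤ_[p][X], ((1 + PowerSeries.X : PowerSeries ℤ_[p]) ^ p ^ e - 1) ∣ L' - (R : PowerSeries ℤ_[p]) →
      (Polynomial.aeval (R := ℤ_[p]) (MonoidAlgebra.of ℤ_[p] _ γ - 1)) R = θ) :
    ((1 + PowerSeries.X : PowerSeries ℤ_[p]) ^ p ^ e - 1) ∣ L - L' := by
  obtain ⟨R, -, hR⟩ := exists_poly_omega_dvd_sub p e L
  obtain ⟨R', -, hR'⟩ := exists_poly_omega_dvd_sub p e L'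
  have h := omega_dvd_coe_sub_of_aeval_eq p γ e hγ hgen hcard ((hL R hR).trans (hL' R' hR').symm)
  have : L - L' = (L - R) + ((R : PowerSeries ℤ_[p]) - R') - (L' - R') := by ring
  rw [this]
  exact dvd_sub (dvd_add hR h) hR'

/-! ### §3 The image relation is a ring homomorphism onto `ℤ_p[G]` -/

/-- The image of a polynomial `P` is `P(γ − 1)`. [folklore] -/
theorem image_coe (γ : G) (e : ℕ) (hγ : γ ^ (p ^ e) = 1) (P : ℤ_[p][X]) :
    ∀ R : ℤ_[p][X], ((1 + PowerSeries.X : PowerSeries ℤ_[p]) ^ p ^ e - 1) ∣ (P : PowerSeries ℤ_[p]) - (R : PowerSeries ℤ_[p]) →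
      (Polynomial.aeval (R := ℤ_[p]) (MonoidAlgebra.of ℤ_[p] _ γ - 1)) R =
        (Polynomial.aeval (R := ℤ_[p]) (MonoidAlgebra.of ℤ_[p] _ γ - 1)) P :=
  fun _ hR => (aeval_eq_of_omega_dvd_coe_sub p γ e hγ hR).symm

/-- The image relation is additive. [folklore] -/
theorem image_add (γ : G) (e : ℕ) (hγ : γ ^ (p ^ e) = 1) {L L' : PowerSeries ℤ_[p]} {θ θ' : MonoidAlgebra ℤ_[p] G}
    (hL : ∀ R : ℤ_[p][X], ((1 + PowerSeries.X : PowerSeries ℤ_[p]) ^ p ^ e - 1) ∣ L - (R : PowerSeries ℤ_[p]) →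
      (Polynomial.aeval (R := ℤ_[p]) (MonoidAlgebra.of ℤ_[p] _ γ - 1)) R = θ)
    (hL' : ∀ R : ℤ_[p][X], ((1 + PowerSeries.X : PowerSeries ℤ_[p]) ^ p ^ e - 1) ∣ L' - (R : PowerSeries ℤ_[p]) →
      (Polynomial.aeval (R := ℤ_[p]) (MonoidAlgebra.of ℤ_[p] _ γ - 1)) R = θ') :
    ∀ R : ℤ_[p][X], ((1 + PowerSeries.X : PowerSeries ℤ_[p]) ^ p ^ e - 1) ∣ (L + L') - (R : PowerSeries ℤ_[p]) →
      (Polynomial.aeval (R := ℤ_[p]) (MonoidAlgebra.of ℤ_[p] _ γ - 1)) R = θ + θ' := by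
  rw [image_iff_exists p γ e hγ]
  obtain ⟨R, -, hR⟩ := exists_poly_omega_dvd_sub p e L
  obtain ⟨R', -, hR'⟩ := exists_poly_omega_dvd_sub p e L'
  refine ⟨R + R', ?_, by rw [map_add, hL R hR, hL' R' hR']⟩
  have : L + L' - ((R + R' : ℤ_[p][X]) : PowerSeries ℤ_[p]) = (L - R) + (L' - R') := by rw [Polynomial.coe_add]; ring
  rw [this]
  exact dvd_add hR hR'

/-- The image relation is multiplicative. [folklore] -/
theorem image_mul (γ : G) (e : ℕ) (hγ : γ ^ (p ^ e) = 1) {L L' : PowerSeries ℤ_[p]} {θ θ' : MonoidAlgebra ℤ_[p] G}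
    (hL : ∀ R : ℤ_[p][X], ((1 + PowerSeries.X : PowerSeries ℤ_[p]) ^ p ^ e - 1) ∣ L - (R : PowerSeries ℤ_[p]) →
      (Polynomial.aeval (R := ℤ_[p]) (MonoidAlgebra.of ℤ_[p] _ γ - 1)) R = θ)
    (hL' : ∀ R : ℤ_[p][X], ((1 + PowerSeries.X : PowerSeries ℤ_[p]) ^ p ^ e - 1) ∣ L' - (R : PowerSeries ℤ_[p]) →
      (Polynomial.aeval (R := ℤ_[p]) (MonoidAlgebra.of ℤ_[p] _ γ - 1)) R = θ') :
    ∀ R : ℤ_[p][X], ((1 + PowerSeries.X : PowerSeries ℤ_[p]) ^ p ^ e - 1) ∣ (L * L') - (R : PowerSeries ℤ_[p]) →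
      (Polynomial.aeval (R := ℤ_[p]) (MonoidAlgebra.of ℤ_[p] _ γ - 1)) R = θ * θ' := by
  rw [image_iff_exists p γ e hγ]
  obtain ⟨R, -, hR⟩ := exists_poly_omega_dvd_sub p e L
  obtain ⟨R', -, hR'⟩ := exists_poly_omega_dvd_sub p e L'
  refine ⟨R * R', ?_, by rw [map_mul, hL R hR, hL' R' hR']⟩
  have : L * L' - ((R * R' : ℤ_[p][X]) : PowerSeries ℤ_[p]) = (L - R) * L' + (R : PowerSeries ℤ_[p]) * (L' - R') := by
    rw [Polynomial.coe_mul]; ring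
  rw [this]
  exact dvd_add (dvd_mul_of_dvd_left hR _) (dvd_mul_of_dvd_right hR' _)

/-- **Onto**: every `θ ∈ ℤ_p[G]` is the image of a power series (indeed of a polynomial, part 1 §2). [folklore] -/
theorem image_surjective (γ : G) (e : ℕ) (hγ : γ ^ (p ^ e) = 1) (hgen : ∀ g : G, ∃ k : ℕ, γ ^ k = g)
    (θ : MonoidAlgebra ℤ_[p] G) :
    ∃ P : ℤ_[p][X], ∀ R : ℤ_[p][X], ((1 + PowerSeries.X : PowerSeries ℤ_[p]) ^ p ^ e - 1) ∣ (P : PowerSeries ℤ_[p]) - (R : PowerSeries ℤ_[p]) →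
      (Polynomial.aeval (R := ℤ_[p]) (MonoidAlgebra.of ℤ_[p] _ γ - 1)) R = θ := by
  obtain ⟨P, hP⟩ := evalGen_surjective p γ hgen θ
  exact ⟨P, fun R hR => (aeval_eq_of_omega_dvd_coe_sub p γ e hγ hR).symm.trans hP⟩

/-! ### §4 Ideals: powers of the augmentation ideal, and divisibility by `p` -/

/-- **`L ∈ (X^ρ)` ⇒ `θ ∈ I^ρ`**: if `X^ρ ∣ L` then the image of `L` lies in the `ρ`-th power of the augmentation ideal
(`X ↦ γ − 1 ∈ I`). [cite: BertoliniDarmon2005, §1.2 (18)–(21)] -/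
theorem mem_augIdeal_pow_of_image (γ : G) (e : ℕ) {L : PowerSeries ℤ_[p]} {θ : MonoidAlgebra ℤ_[p] G}
    (hL : ∀ R : ℤ_[p][X], ((1 + PowerSeries.X : PowerSeries ℤ_[p]) ^ p ^ e - 1) ∣ L - (R : PowerSeries ℤ_[p]) →
      (Polynomial.aeval (R := ℤ_[p]) (MonoidAlgebra.of ℤ_[p] _ γ - 1)) R = θ)
    (ρ : ℕ) (hρ : (PowerSeries.X : PowerSeries ℤ_[p]) ^ ρ ∣ L) : θ ∈ augIdeal ℤ_[p] G ^ ρ := by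
  obtain ⟨M, rfl⟩ := hρ
  obtain ⟨R, -, hR⟩ := exists_poly_omega_dvd_sub p e M
  have himg : (Polynomial.aeval (R := ℤ_[p]) (MonoidAlgebra.of ℤ_[p] _ γ - 1)) (Polynomial.X ^ ρ * R) = θ := by
    refine hL _ ?_
    rw [Polynomial.coe_mul, Polynomial.coe_pow, Polynomial.coe_X, ← mul_sub]
    exact dvd_mul_of_dvd_right hR _
  rw [← himg, map_mul, map_pow, Polynomial.aeval_X]
  refine Ideal.mul_mem_right _ _ (Ideal.pow_mem_pow ?_ ρ)
  exact Literature.NumberTheory.EllipticCurves.single_sub_one_mem_augIdeal ℤ_[p] G γ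

/-- **`θ ∈ I^ρ` ⇒ `L ≡ X^ρ · Q (mod ω_e)`** for some polynomial `Q` (`γ` a generator, `#G = p^e`: `I^ρ = ((γ−1)^ρ)`, part 1 §4,
and `ℤ_p[X] → ℤ_p[G]` is onto). [cite: BertoliniDarmon2005, §1.2 (18)–(21)] -/
theorem exists_X_pow_mul_of_mem_augIdeal_pow [Finite G] (γ : G) (e : ℕ) (hγ : γ ^ (p ^ e) = 1)
    (hgen : ∀ g : G, ∃ k : ℕ, γ ^ k = g) (hcard : Nat.card G = p ^ e) {L : PowerSeries ℤ_[p]} {θ : MonoidAlgebra ℤ_[p] G}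
    (hL : ∀ R : ℤ_[p][X], ((1 + PowerSeries.X : PowerSeries ℤ_[p]) ^ p ^ e - 1) ∣ L - (R : PowerSeries ℤ_[p]) →
      (Polynomial.aeval (R := ℤ_[p]) (MonoidAlgebra.of ℤ_[p] _ γ - 1)) R = θ)
    (ρ : ℕ) (hθ : θ ∈ augIdeal ℤ_[p] G ^ ρ) :
    ∃ Q : ℤ_[p][X], ((1 + PowerSeries.X : PowerSeries ℤ_[p]) ^ p ^ e - 1) ∣
      L - (PowerSeries.X : PowerSeries ℤ_[p]) ^ ρ * (Q : PowerSeries ℤ_[p]) := by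
  rw [augIdeal_pow_eq_span_of_gen (R := ℤ_[p]) γ hgen ρ, Ideal.mem_span_singleton] at hθ
  obtain ⟨η, hη⟩ := hθ
  obtain ⟨Q, hQ⟩ := evalGen_surjective p γ hgen η
  refine ⟨Q, ?_⟩
  obtain ⟨R, -, hR⟩ := exists_poly_omega_dvd_sub p e L
  have h1 : (Polynomial.aeval (R := ℤ_[p]) (MonoidAlgebra.of ℤ_[p] _ γ - 1)) R =
      (Polynomial.aeval (R := ℤ_[p]) (MonoidAlgebra.of ℤ_[p] _ γ - 1)) (Polynomial.X ^ ρ * Q) := by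
    rw [hL R hR, hη, map_mul, map_pow, Polynomial.aeval_X, hQ]
  have h2 := omega_dvd_coe_sub_of_aeval_eq p γ e hγ hgen hcard h1
  have : L - (PowerSeries.X : PowerSeries ℤ_[p]) ^ ρ * (Q : PowerSeries ℤ_[p]) =
      (L - R) + ((R : PowerSeries ℤ_[p]) - ((Polynomial.X ^ ρ * Q : ℤ_[p][X]) : PowerSeries ℤ_[p])) := by
    rw [Polynomial.coe_mul, Polynomial.coe_pow, Polynomial.coe_X]; ring
  rw [this]
  exact dvd_add hR h2

/-- **`p ∣ L` ⇒ no coefficient of `θ` is a unit**: the image of `p · M` is `p · (image of M)`, whose coefficients lie in `pℤ_p`.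
[folklore] -/
theorem not_isUnit_coeff_of_image_of_C_dvd (γ : G) (e : ℕ) {L : PowerSeries ℤ_[p]}
    {θ : MonoidAlgebra ℤ_[p] G}
    (hL : ∀ R : ℤ_[p][X], ((1 + PowerSeries.X : PowerSeries ℤ_[p]) ^ p ^ e - 1) ∣ L - (R : PowerSeries ℤ_[p]) →
      (Polynomial.aeval (R := ℤ_[p]) (MonoidAlgebra.of ℤ_[p] _ γ - 1)) R = θ)
    (hdvd : (PowerSeries.C (p : ℤ_[p]) : PowerSeries ℤ_[p]) ∣ L) (g : G) : ¬ IsUnit (θ.coeff g) := by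
  obtain ⟨M, rfl⟩ := hdvd
  obtain ⟨R, -, hR⟩ := exists_poly_omega_dvd_sub p e M
  have himg : (Polynomial.aeval (R := ℤ_[p]) (MonoidAlgebra.of ℤ_[p] _ γ - 1)) (Polynomial.C (p : ℤ_[p]) * R) = θ := by
    refine hL _ ?_
    rw [Polynomial.coe_mul, Polynomial.coe_C, ← mul_sub]
    exact dvd_mul_of_dvd_right hR _
  rw [← himg, map_mul, Polynomial.aeval_C, MonoidAlgebra.coe_algebraMap, Function.comp_apply, Algebra.algebraMap_self_apply,
    MonoidAlgebra.coeff_single_one_mul]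
  intro hu
  exact not_isUnit_p p (isUnit_of_mul_isUnit_left hu)

/-- **No unit coefficient ⇒ `p ∣ coeff_k L` for every `k < e`**: if every coefficient of the image `θ` of `L` is a non-unit then
`θ = p · η`, `η` is the image of a polynomial `Q`, so `ω_e ∣ L − pQ` and `p^{e−k} ∣ coeff_k L − p coeff_k Q` (§1). [folklore] -/
theorem dvd_coeff_of_image_of_forall_not_isUnit [Finite G] (γ : G) (e : ℕ) (hγ : γ ^ (p ^ e) = 1)
    (hgen : ∀ g : G, ∃ k : ℕ, γ ^ k = g) (hcard : Nat.card G = p ^ e) {L : PowerSeries ℤ_[p]} {θ : MonoidAlgebra ℤ_[p] G}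
    (hL : ∀ R : ℤ_[p][X], ((1 + PowerSeries.X : PowerSeries ℤ_[p]) ^ p ^ e - 1) ∣ L - (R : PowerSeries ℤ_[p]) →
      (Polynomial.aeval (R := ℤ_[p]) (MonoidAlgebra.of ℤ_[p] _ γ - 1)) R = θ)
    (hθ : ∀ g : G, ¬ IsUnit (θ.coeff g)) (k : ℕ) (hk : k < e) : (p : ℤ_[p]) ∣ PowerSeries.coeff k L := by
  classical
  -- θ = p • η with η ∈ ℤ_p[G]
  have hcoef : ∀ g : G, ∃ c : ℤ_[p], θ.coeff g = p * c := by
    intro g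
    have h1 : θ.coeff g ∈ IsLocalRing.maximalIdeal ℤ_[p] := (IsLocalRing.mem_maximalIdeal _).mpr (hθ g)
    rw [PadicInt.maximalIdeal_eq_span_p, Ideal.mem_span_singleton] at h1
    exact h1
  choose c hc using hcoef
  set η : MonoidAlgebra ℤ_[p] G := MonoidAlgebra.ofCoeff (Finsupp.onFinset θ.coeff.support c (fun g hg => by
    rw [Finsupp.mem_support_iff]; intro h0; apply hg; have := hc g; rw [h0] at this
    exact (mul_eq_zero.mp this.symm).resolve_left (by exact_mod_cast hp.out.ne_zero))) with hηdef
  have hηg : ∀ g : G, η.coeff g = c g := fun g => by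
    rw [hηdef, MonoidAlgebra.coeff_ofCoeff, Finsupp.onFinset_apply]
  have hθη : θ = MonoidAlgebra.single (1 : G) (p : ℤ_[p]) * η := by
    refine MonoidAlgebra.ext (Finsupp.ext fun g => ?_)
    rw [MonoidAlgebra.coeff_single_one_mul, hηg, hc]
  obtain ⟨Q, hQ⟩ := evalGen_surjective p γ hgen η
  obtain ⟨R, -, hR⟩ := exists_poly_omega_dvd_sub p e L
  have h1 : (Polynomial.aeval (R := ℤ_[p]) (MonoidAlgebra.of ℤ_[p] _ γ - 1)) R =
      (Polynomial.aeval (R := ℤ_[p]) (MonoidAlgebra.of ℤ_[p] _ γ - 1)) (Polynomial.C (p : ℤ_[p]) * Q) := by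
    rw [hL R hR, hθη, map_mul, Polynomial.aeval_C, MonoidAlgebra.coe_algebraMap, Function.comp_apply, Algebra.algebraMap_self_apply, hQ]
  have h2 := omega_dvd_coe_sub_of_aeval_eq p γ e hγ hgen hcard h1
  have h3 : ((1 + PowerSeries.X : PowerSeries ℤ_[p]) ^ p ^ e - 1) ∣ L - PowerSeries.C (p : ℤ_[p]) * (Q : PowerSeries ℤ_[p]) := by
    have : L - PowerSeries.C (p : ℤ_[p]) * (Q : PowerSeries ℤ_[p]) =
        (L - R) + ((R : PowerSeries ℤ_[p]) - ((Polynomial.C (p : ℤ_[p]) * Q : ℤ_[p][X]) : PowerSeries ℤ_[p])) := by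
      rw [Polynomial.coe_mul, Polynomial.coe_C]; ring
    rw [this]; exact dvd_add hR h2
  have h4 := pow_dvd_coeff_of_omega_dvd p e k h3
  rw [map_sub, PowerSeries.coeff_C_mul] at h4
  have h5 : (p : ℤ_[p]) ∣ (p : ℤ_[p]) ^ (e - k) := dvd_pow_self _ (by omega)
  have h6 := h5.trans h4
  have : PowerSeries.coeff k L = (PowerSeries.coeff k L - p * PowerSeries.coeff k (Q : PowerSeries ℤ_[p])) +
      p * PowerSeries.coeff k (Q : PowerSeries ℤ_[p]) := by ring
  rw [this]
  exact dvd_add h6 (dvd_mul_right _ _)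

end Level

end Summit.BirchSwinnertonDyer.BirchSwinnertonDyer.Theorems.TowerSqrt

end
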